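import Summits.BirchSwinnertonDyer.BirchSwinnertonDyer.Theorems.EisensteinDepletionAtTwoStarDoorFourPrints
import Summits.BirchSwinnertonDyer.BirchSwinnertonDyer.Theorems.EisensteinDepletionAtTwoStarOptBSigmaNodeFifteenAll
import Literature.NumberTheory.EllipticCurves.ManinConstantDeuringTwistProofs
import HarnessLib

/-!
# Line `star` on crux E1M (stmt-BirchSwinnertonDyer-20341): `StarOptB` AT EVERY LEVEL from (N256) + UBD (+ Edixhoven, discharged) — the optimal
# `Γ₁(N)`-datum print leaves E1M; END-STATE DOOR v16: E1M from THREE named facts (lead star-p1 GEN 20)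

Up to v15 (GEN 19) the line proved `StarOptB` (aside item 24445) by cases on `Squarefree N_W`: the squarefree half from the node law (N256) via the two
position laws (T1) ∧ (T2) (`SfPositions.starOptBSF_of_positions`, print-free given (N256) + UBD + Edixhoven), the NON-squarefree half by line nsf's
door `NsfDoorPrint.starOptBNSF_of_print`, which consumes the PRINT `exists_optimal_gamma1ParametrizationData` (the optimal `Γ₁(N)`-datum, CES 2003 §6.1 /
Stevens 1989) and modularity.  But the squarefree hypothesis of the first chain was idle except at ONE point — the level bookkeeping excluding the `15a1`
shape — and Theorems/…StarOptBSigmaNodeFifteenAll (GEN 20) removes it there (`W₀ ≅ 15a1 ⇒ N_{W₀} = 15 = N_W` by Ogg–Saito at good `2`).  Hence the node-law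
chain runs at EVERY level:

* `MidWalk.optimalNotMidPointed_of_partnerNotCentre_all` — (T2) «no MID-pointed optimal curve in a habitat class, `N_W ≠ 15`» from (T2′), ALL levels
  (the MID walk `not_typeAB_of_midPoint` verbatim; only the `Squarefree` binder is gone);
* `SfPositions.starOptB_of_positions_all` — **`StarOptB` (the route decl, all levels) from (T1) ∧ (T2)-all-levels**, print-free (Vieta + regime transport,
  as `starOptBSF_of_positions`);
* `SigmaNode.starOptB_of_sigmaNode_all` — `StarOptB` from (N256) + UBD + Edixhoven; `SigmaNode.starOptB_of_twoPrints` — from (F) + UBD (Edixhoven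
  discharged by the tree theorem `edixhoven_optimalManinConstant_integral_holds`; NO modularity, NO `Γ₁`-datum);
* `SigmaNode.starOptBNSF_of_twoPrints` — the non-squarefree crux `StarOptBNSF` (item 27047) likewise from (F) + UBD (an ALTERNATIVE to line nsf's
  `Γ₁`-datum door, recorded for the tenure planner; not a removal there but a trade);
* **`SigmaNode.depletedLambdaLawAtTwoMod_of_threePrints : (F) → Abbes–Ullmo → UBD → DepletedLambdaLawAtTwoMod`** — THE END-STATE DOOR v16:
  E1M (item 20341, all conductors) from THREE named published facts {(F) `gamma1Parametrization_cuspImage_nonsingularReduction` (CES 2003 §6.1.2 / KM 12.6 /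
  ATAEC IV.9.1), `abbesUllmo_not_dvd_maninConstant_of_not_dvd_level` (Abbes–Ullmo 1996 Thm A, line kummer's `StarGO2Sigma` half),
  `CalegariDimitrovTang2025_unboundedDenominators`} + modularity (E1M's own binder).

HONEST FRAMING (Barrier B1): CONDITIONAL results — E1M is proved only modulo the three named facts (hypotheses), none discharged here.  Nothing here reads
`r_an`; E1M as an ITEM, E1M_NSF, the leaf T-r3₂ and BSD are NOT proved (PARTITION D-0054: none — r_an ≥ 2, axis S0; no S0 motion).  No `sorry`, no definition.
-/

set_option linter.dupNamespace false
set_option autoImplicit false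

noncomputable section

open scoped Classical MatrixGroups
open CongruenceSubgroup
open WeierstrassCurve Literature.NumberTheory.EllipticCurves Literature.NumberTheory.EllipticCurves.Greenberg1999
open Literature.NumberTheory.EllipticCurves.ModularForms

namespace Summit.BirchSwinnertonDyer.BirchSwinnertonDyer.Theorems.DepletionAtTwo

/-! ### §1 (T2) from (T2′), every level — the MID walk -/

namespace MidWalk

/-- **(T2) «no MID-pointed optimal curve in a habitat class, `N_W ≠ 15`» from (T2′) «the MID point's partner is not a centre», AT EVERY LEVEL** —
`optimalNotMidPointed_of_partnerNotCentre` verbatim without the `Squarefree (W.conductorNorm ℤ)` binder (it was only passed to (T2′)): factor `W₀ ~ W` as a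
2-power isogeny `W₀ → V` and an odd isogeny `W → V` (`stub_isogenyFactor`), transport the habitat point along the odd isogeny (`stub_oddIsoUnique/TwoAdic/Arch`),
`not_typeAB_of_midPoint`.  CONDITIONAL on (T2′). [cite: GreenbergLNM1716, §5 Props. 5.13–5.14 (pp. 120–121)] [cite: SilvermanAEC2009, III.4.12 and III.6.1] -/
theorem optimalNotMidPointed_of_partnerNotCentre_all
    (hT2' : ∀ (W : WeierstrassCurve ℚ) [W.IsElliptic] [W.IsGloballyMinimal] (x : ℚ), IsOrdinaryAt W 2 →
      HasUniqueRationalTwoTorsionX W x →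
      ((TwoTorsionRamifiedAtTwo x ∧ ¬ TwoTorsionOdd W x) ∨ (TwoTorsionOdd W x ∧ ¬ TwoTorsionRamifiedAtTwo x)) →
      W.conductorNorm ℤ ≠ 15 →
      ∀ ⦃N : ℕ⦄ [NeZero N] (f : CuspForm (Gamma0 N) 2), IsNewformOf W f →
      ∀ (W₀ : WeierstrassCurve ℚ) [W₀.IsElliptic] [W₀.IsGloballyMinimal], IsNewformOf W₀ f →
      ∀ (L₀ : PeriodPair), IsNeronLatticeOf (W₀.baseChange ℂ) L₀ → ∀ (q : ℚ), q ≠ 0 →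
      (∀ z ∈ periodLattice f, (q : ℂ) * z ∈ L₀.lattice) → (∀ z ∈ L₀.lattice, ∃ w ∈ periodLattice f, z = (q : ℂ) * w) →
      ∀ (x₀ : ℚ), HasRationalTwoTorsionX W₀ x₀ → TwoTorsionRamifiedAtTwo x₀ → TwoTorsionOdd W₀ x₀ →
      ¬ IsSquare ((W₀.b₄ + x₀ * W₀.b₂ + 6 * x₀ ^ 2) / 2)) :
    ∀ (W : WeierstrassCurve ℚ) [W.IsElliptic] [W.IsGloballyMinimal] (x : ℚ), IsOrdinaryAt W 2 →
      HasUniqueRationalTwoTorsionX W x →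
      ((TwoTorsionRamifiedAtTwo x ∧ ¬ TwoTorsionOdd W x) ∨ (TwoTorsionOdd W x ∧ ¬ TwoTorsionRamifiedAtTwo x)) →
      W.conductorNorm ℤ ≠ 15 →
      ∀ ⦃N : ℕ⦄ [NeZero N] (f : CuspForm (Gamma0 N) 2), IsNewformOf W f →
      ∀ (W₀ : WeierstrassCurve ℚ) [W₀.IsElliptic] [W₀.IsGloballyMinimal], IsNewformOf W₀ f →
      ∀ (L₀ : PeriodPair), IsNeronLatticeOf (W₀.baseChange ℂ) L₀ → ∀ (q : ℚ), q ≠ 0 →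
      (∀ z ∈ periodLattice f, (q : ℂ) * z ∈ L₀.lattice) → (∀ z ∈ L₀.lattice, ∃ w ∈ periodLattice f, z = (q : ℂ) * w) →
      ∀ (x₀ : ℚ), HasRationalTwoTorsionX W₀ x₀ → TwoTorsionRamifiedAtTwo x₀ → ¬ TwoTorsionOdd W₀ x₀ := by
  intro W _ _ x hord hux htype h15 N _ f hW W₀ _ _ hW₀ L₀ hL₀ q hq hin hout x₀ hx₀ hR₀ hO₀
  have hnsq := hT2' W x hord hux htype h15 f hW W₀ hW₀ L₀ hL₀ q hq hin hout x₀ hx₀ hR₀ hO₀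
  have hiso : WeierstrassCurve.IsIsogenous W W₀ :=
    IsNewformOf.isIsogenous WeierstrassCurve.isIsogenous_iff_frobeniusTrace_eq_holds hW hW₀
  have hiso' : WeierstrassCurve.IsIsogenous W₀ W := WeierstrassCurve.IsIsogenous.symm_of_charZero hiso
  have hord₀ : IsOrdinaryAt W₀ 2 := IsogenyMuShift.isOrdinaryAt_of_isIsogenous hiso hord
  obtain ⟨V, hVell, hVmin, φ₁, ψ, hk, hodd⟩ :=
    Summit.BirchSwinnertonDyer.BirchSwinnertonDyer.Theorems.EisensteinDepletionAtTwoStarOptBNSFStubIsogenyFactor.stub_isogenyFactor W₀ W hiso'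
  haveI := hVell
  haveI := hVmin
  -- the habitat point of `W` transported to `V` along the odd isogeny `ψ : W → V`
  obtain ⟨xV, huV⟩ := NsfStubs.stub_oddIsoUnique W V ψ hodd x hux
  have hRiff := NsfStubs.stub_oddIsoTwoAdic W V ψ hodd hord x xV hux huV
  have hOiff := NsfStubs.stub_oddIsoArch W V ψ hodd x xV hux huV
  have htypeV : (TwoTorsionRamifiedAtTwo xV ∧ ¬ TwoTorsionOdd V xV) ∨ (TwoTorsionOdd V xV ∧ ¬ TwoTorsionRamifiedAtTwo xV) := by
    rcases htype with ⟨hR, hnO⟩ | ⟨hO, hnR⟩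
    · exact Or.inl ⟨hRiff.mp hR, fun h ↦ hnO (hOiff.mpr h)⟩
    · exact Or.inr ⟨hOiff.mp hO, fun h ↦ hnR (hRiff.mpr h)⟩
  exact not_typeAB_of_midPoint W₀ hord₀ hx₀ hR₀ hO₀ hnsq V φ₁ hk huV htypeV

end MidWalk

/-! ### §2 `StarOptB` (all levels) from the two position laws -/

namespace SfPositions

/-- **`StarOptB` (the route decl `Theses.EisensteinDepletionAtTwo.StarOptB`, EVERY level `N_W ≠ 15`) FROM THE TWO POSITION LAWS, print-free** — the
statement and proof of `starOptBSF_of_positions` without the `Squarefree` binder: (T1) «the lattice-optimal curve (good ordinary at 2) is never of type A»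
(all levels, as before) and (T2) «in a habitat class with `N_W ≠ 15` the optimal curve has no rational 2-torsion abscissa that is ramified AND odd» (now all
levels).  No ramified rational abscissa on `W₀` ⇒ `NsfReduction.regimeTransport`; a ramified one `x_f` ⇒ not odd (T2) ⇒ the rational 2-torsion is not unique
(T1) ⇒ `exists_odd_etale_of_two_rat`.  CONDITIONAL on (T1), (T2). [cite: GreenbergLNM1716, §5 Props. 5.13–5.14 (pp. 120–121)] [cite: Stevens1989, §2] -/
theorem starOptB_of_positions_all
    (hT1 : ∀ (W₀ : WeierstrassCurve ℚ) [W₀.IsElliptic] [W₀.IsGloballyMinimal]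
      ⦃N : ℕ⦄ [NeZero N] (f : CuspForm (Gamma0 N) 2), IsNewformOf W₀ f → IsOrdinaryAt W₀ 2 →
      ∀ (L₀ : PeriodPair), IsNeronLatticeOf (W₀.baseChange ℂ) L₀ → ∀ (q : ℚ), q ≠ 0 →
      (∀ z ∈ periodLattice f, (q : ℂ) * z ∈ L₀.lattice) → (∀ z ∈ L₀.lattice, ∃ w ∈ periodLattice f, z = (q : ℂ) * w) →
      ∀ (x₀ : ℚ), HasUniqueRationalTwoTorsionX W₀ x₀ → TwoTorsionRamifiedAtTwo x₀ → TwoTorsionOdd W₀ x₀)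
    (hT2 : ∀ (W : WeierstrassCurve ℚ) [W.IsElliptic] [W.IsGloballyMinimal] (x : ℚ), IsOrdinaryAt W 2 →
      HasUniqueRationalTwoTorsionX W x →
      ((TwoTorsionRamifiedAtTwo x ∧ ¬ TwoTorsionOdd W x) ∨ (TwoTorsionOdd W x ∧ ¬ TwoTorsionRamifiedAtTwo x)) →
      W.conductorNorm ℤ ≠ 15 →
      ∀ ⦃N : ℕ⦄ [NeZero N] (f : CuspForm (Gamma0 N) 2), IsNewformOf W f →
      ∀ (W₀ : WeierstrassCurve ℚ) [W₀.IsElliptic] [W₀.IsGloballyMinimal], IsNewformOf W₀ f →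
      ∀ (L₀ : PeriodPair), IsNeronLatticeOf (W₀.baseChange ℂ) L₀ → ∀ (q : ℚ), q ≠ 0 →
      (∀ z ∈ periodLattice f, (q : ℂ) * z ∈ L₀.lattice) → (∀ z ∈ L₀.lattice, ∃ w ∈ periodLattice f, z = (q : ℂ) * w) →
      ∀ (x₀ : ℚ), HasRationalTwoTorsionX W₀ x₀ → TwoTorsionRamifiedAtTwo x₀ → ¬ TwoTorsionOdd W₀ x₀) :
    Summit.BirchSwinnertonDyer.BirchSwinnertonDyer.Theses.EisensteinDepletionAtTwo.StarOptB := by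
  intro W _ _ x hord hux htype h15 N _ f hW W₀ _ _ hW₀ L₀ hL₀ q hq hin hout
  have hiso : WeierstrassCurve.IsIsogenous W W₀ :=
    IsNewformOf.isIsogenous WeierstrassCurve.isIsogenous_iff_frobeniusTrace_eq_holds hW hW₀
  have hord₀ : IsOrdinaryAt W₀ 2 := IsogenyMuShift.isOrdinaryAt_of_isIsogenous hiso hord
  by_cases hno : ∃ x₀ : ℚ, HasRationalTwoTorsionX W₀ x₀ ∧ TwoTorsionRamifiedAtTwo x₀
  · obtain ⟨xf, hxf, hRf⟩ := hno
    -- (T2): the ramified abscissa is not odd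
    have hOf : ¬ TwoTorsionOdd W₀ xf := hT2 W x hord hux htype h15 f hW W₀ hW₀ L₀ hL₀ q hq hin hout xf hxf hRf
    -- (T1): hence the rational 2-torsion of `W₀` is not unique
    have hnu : ¬ HasUniqueRationalTwoTorsionX W₀ xf := fun hu ↦ hOf (hT1 W₀ f hW₀ hord₀ L₀ hL₀ q hq hin hout xf hu hRf)
    have hother : ∃ b : ℚ, HasRationalTwoTorsionX W₀ b ∧ b ≠ xf := by
      by_contra hcon
      push Not at hcon
      exact hnu ⟨hxf, fun z hz ↦ hcon z hz⟩
    obtain ⟨b, hb, hbf⟩ := hother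
    exact exists_odd_etale_of_two_rat W₀ hord₀.1 hxf hb (Ne.symm hbf) hRf hOf
  · exact NsfReduction.regimeTransport W x hord hux htype W₀ hiso hno

end SfPositions

/-! ### §3 The doors by name -/

namespace SigmaNode

/-- **`StarOptB` (EVERY level) from the node law (N256) and the prints UBD + Edixhoven** — (T1) `optimalNotTypeA_of_sigmaNode`, (T2′)
`partnerNotCentre_of_sigmaNode_all`, (T2) `MidWalk.optimalNotMidPointed_of_partnerNotCentre_all`, glued by `SfPositions.starOptB_of_positions_all`.  No case
split on `Squarefree N_W`, no `Γ₁(N)`-datum, no modularity.  CONDITIONAL on UBD, Edixhoven, (N256).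
[cite: CalegariDimitrovTang2025, Thm. 1.0.1] [cite: Edixhoven1991, Prop. 2] [cite: GreenbergLNM1716, §5 Props. 5.13–5.14] -/
theorem starOptB_of_sigmaNode_all
    (hU : Literature.NumberTheory.Automorphic.CalegariDimitrovTang2025_unboundedDenominators)
    (hEd : edixhoven_optimalManinConstant_integral)
    (hN : ∀ (W₀ : WeierstrassCurve ℚ) [W₀.IsElliptic] [W₀.IsGloballyMinimal]
      ⦃N : ℕ⦄ [NeZero N] (f : CuspForm (Gamma0 N) 2), IsNewformOf W₀ f → IsOrdinaryAt W₀ 2 →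
      ∀ (L₀ : PeriodPair), IsNeronLatticeOf (W₀.baseChange ℂ) L₀ → ∀ (q : ℚ), q ≠ 0 →
      (∀ z ∈ periodLattice f, (q : ℂ) * z ∈ L₀.lattice) → (∀ z ∈ L₀.lattice, ∃ w ∈ periodLattice f, z = (q : ℂ) * w) →
      ∀ (x : ℚ), HasRationalTwoTorsionX W₀ x → TwoTorsionRamifiedAtTwo x →
      ∀ (lam : ℂ), lam ∈ L₀.lattice → lam / 2 ∉ L₀.lattice →
        L₀.weierstrassP (lam / 2) - ((W₀.b₂ : ℚ) : ℂ) / 12 = ((x : ℚ) : ℂ) →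
      (∀ (γ : SL(2, ℤ)) (hγ : γ ∈ Gamma0 N), γ ∈ Gamma1 N →
        ∃ k : ℤ, ∃ w ∈ L₀.lattice, (q : ℂ) * cuspSymbol f ⟨γ, hγ⟩ = (k : ℂ) * lam + 2 * w) →
      (W₀.b₂ + 12 * x) ^ 2 - 32 * (W₀.b₄ + x * W₀.b₂ + 6 * x ^ 2) = 256 ∨
        (W₀.b₂ + 12 * x) ^ 2 - 32 * (W₀.b₄ + x * W₀.b₂ + 6 * x ^ 2) = -256) :
    Summit.BirchSwinnertonDyer.BirchSwinnertonDyer.Theses.EisensteinDepletionAtTwo.StarOptB :=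
  SfPositions.starOptB_of_positions_all (optimalNotTypeA_of_sigmaNode hU hEd hN)
    (MidWalk.optimalNotMidPointed_of_partnerNotCentre_all (partnerNotCentre_of_sigmaNode_all hU hEd hN))

/-- **`StarOptB` (aside item 24445, EVERY level) from TWO prints: (F) cusp non-singularity and UBD** — (N256) at all levels from (F) + Edixhoven
(`sigmaNode_of_cuspImageNonsingular`), Edixhoven DISCHARGED by the tree theorem `edixhoven_optimalManinConstant_integral_holds`; then `starOptB_of_sigmaNode_all`.
No modularity, no `Γ₁(N)`-datum (v15 needed both for the non-squarefree half).  CONDITIONAL on (F), UBD.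
[cite: ConradEdixhovenStein2003, §6.1.2 proof of Lemma 6.1.6 (p. 381)] [cite: CalegariDimitrovTang2025, Thm. 1.0.1] [cite: EdixhovenManin1991, Prop. 2] -/
theorem starOptB_of_twoPrints (hF : gamma1Parametrization_cuspImage_nonsingularReduction)
    (hU : Literature.NumberTheory.Automorphic.CalegariDimitrovTang2025_unboundedDenominators) :
    Summit.BirchSwinnertonDyer.BirchSwinnertonDyer.Theses.EisensteinDepletionAtTwo.StarOptB :=
  starOptB_of_sigmaNode_all hU edixhoven_optimalManinConstant_integral_holds
    (sigmaNode_of_cuspImageNonsingular hF edixhoven_optimalManinConstant_integral_holds)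

/-- **`StarOptBNSF` (crux item 27047 = `StarOptB` at NON-squarefree level) from the same TWO prints (F) + UBD** — `starOptB_of_twoPrints` with the extra
binder dropped.  An ALTERNATIVE to line nsf's door `NsfDoorPrint.starOptBNSF_of_print` (modularity + `Γ₁`-datum + UBD): it trades the `Γ₁(N)`-datum and
modularity for (F).  CONDITIONAL on (F), UBD; item 27047 is NOT closed by this. [cite: ConradEdixhovenStein2003, §6.1.2 proof of Lemma 6.1.6 (p. 381)]
[cite: CalegariDimitrovTang2025, Thm. 1.0.1] -/
theorem starOptBNSF_of_twoPrints (hF : gamma1Parametrization_cuspImage_nonsingularReduction)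
    (hU : Literature.NumberTheory.Automorphic.CalegariDimitrovTang2025_unboundedDenominators) :
    Summit.BirchSwinnertonDyer.BirchSwinnertonDyer.Theses.EisensteinDepletionAtTwo.StarOptBNSF := by
  intro W _ _ x hord hx hAB h15 _ N _ f hf W₀ _ _ hf₀ L₀ hL₀ q hq hin hout
  exact starOptB_of_twoPrints hF hU W x hord hx hAB h15 f hf W₀ hf₀ L₀ hL₀ q hq hin hout

/-- **THE END-STATE DOOR OF LINE `star`, v16: E1M `DepletedLambdaLawAtTwoMod` (item 20341, all conductors) from THREE named published facts, BY NAME** —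
modularity (E1M's own binder) gives `StarGO2Sigma` through line kummer's door (`KummerDoor.starGO2Sigma_of_modularity_abbesUllmo_ubd`: Abbes–Ullmo, UBD),
`StarOptB` comes from `starOptB_of_twoPrints` ((F), UBD), and the Σ-glue `depletedLambdaLawAtTwoMod_of_starGO2Sigma` concludes.  Compared with v15
(`depletedLambdaLawAtTwoMod_of_fourPrints`) the optimal `Γ₁(N)`-datum `exists_optimal_gamma1ParametrizationData` is NO LONGER a hypothesis.
CONDITIONAL on the three facts; E1M as an item / BSD NOT proved. [cite: GreenbergVatsal2000, §3 Thm. (3.12), display (28)]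
[cite: ConradEdixhovenStein2003, §6.1.2 proof of Lemma 6.1.6 (p. 381)] [cite: AbbesUllmo1996, Thm. A] [cite: CalegariDimitrovTang2025, Thm. 1.0.1] -/
theorem depletedLambdaLawAtTwoMod_of_threePrints (hF : gamma1Parametrization_cuspImage_nonsingularReduction)
    (hAU : abbesUllmo_not_dvd_maninConstant_of_not_dvd_level)
    (hU : Literature.NumberTheory.Automorphic.CalegariDimitrovTang2025_unboundedDenominators) :
    Summit.BirchSwinnertonDyer.BirchSwinnertonDyer.Theses.EisensteinDepletionAtTwo.DepletedLambdaLawAtTwoMod := by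
  intro hmod
  have hnf : exists_isNewformOf := hmod
  exact depletedLambdaLawAtTwoMod_of_starGO2Sigma (KummerDoor.starGO2Sigma_of_modularity_abbesUllmo_ubd hnf hAU hU)
    (starOptB_of_twoPrints hF hU) hmod

end SigmaNode

end Summit.BirchSwinnertonDyer.BirchSwinnertonDyer.Theorems.DepletionAtTwo

end
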